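import Mathlib
import HarnessLib
import Literature.Probability.LatticeModels.MaxwellKernelBand
import Literature.Probability.LatticeModels.TorusGreenHeatKernel

/-!
# The zero-mode-free torus Green function: Poisson equation in position space and the isotropy
# of its second differences at the origin

Route-independent lattice analysis (no `Theses` import) feeding the parity-free lower half of the crux
stmt-QuantumFields-25881 of the abelian comparison line `U1DipoleHelicity` (LINE 4 of the ideator cell
ym-idea-2; not a rung of `YangMills`): the optimal test form of the lattice Bogoliubov inequality is
built from `G̃_L = torusGreen` (`LatticeGreenFunction.lean`, `(ℤ/Lℤ)^d`, Fourier definition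
`G̃_L(z) = L^{-d} Σ_{k≠0} cos(p_k·z)/ε(p_k)`), and its norm reduces to the two facts proved here:

* `sum_secondDiff_torusGreen` — **Poisson equation**: `Σ_μ (2G̃(z) − G̃(z+e_μ) − G̃(z−e_μ)) = 2([z = 0] − L^{-d})`
  (from the tree's Fourier form of the second differences, `torusGreen_second_difference`, the identity
  `Σ_μ 2(1 − cos p_μ) = 2ε(p)` and orthogonality of the torus characters `sum_torusChar_left`);
* `secondDiff_torusGreen_zero_eq` — **isotropy at the origin**: `2G̃(0) − G̃(e_μ) − G̃(−e_μ)` does not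
  depend on `μ` (coordinate permutation of the momentum sum); hence
  `secondDiff_torusGreen_zero : 2G̃(0) − G̃(e_μ) − G̃(−e_μ) = 2(1 − L^{-d})/d`;
* `sum_secondDiff_torusGreen_eq_zero` — `Σ_z (2G̃(z) − G̃(z+e_μ) − G̃(z−e_μ)) = 0` (translation invariance).

Nothing here bears on the Yang–Mills mass gap.
-/

noncomputable section

namespace Summit.QuantumFields.YangMills.Theorems.U1DipoleHelicity

open Finset
open Literature.Probability.LatticeModels

variable {d L : ℕ} [NeZero L]

/-- Orthogonality of the torus characters, real part: `Σ_k cos(p_k·z) = L^d [z = 0]`. [folklore] -/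
theorem sum_cos_latticeMomentum (z : TorusSite d L) :
    ∑ k : TorusSite d L, Real.cos (∑ i, latticeMomentum L k i * ((z i).val : ℝ)) =
      if z = 0 then (L : ℝ) ^ d else 0 := by
  have h := sum_torusChar_left (d := d) (L := L) z
  have hre := congrArg Complex.re h
  rw [Complex.re_sum] at hre
  simp_rw [torusChar_re] at hre
  rw [hre]
  split_ifs
  · norm_cast
  · simp

/-- The same sum with the zero momentum removed: `Σ_{k ≠ 0} cos(p_k·z) = L^d [z = 0] − 1`. [folklore] -/
theorem sum_erase_cos_latticeMomentum (z : TorusSite d L) :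
    ∑ k ∈ (univ : Finset (TorusSite d L)).erase 0,
        Real.cos (∑ i, latticeMomentum L k i * ((z i).val : ℝ)) =
      (if z = 0 then (L : ℝ) ^ d else 0) - 1 := by
  rw [← sum_cos_latticeMomentum z, ← Finset.sum_erase_add _ _ (Finset.mem_univ (0 : TorusSite d L))]
  simp [latticeMomentum]

/-- **Poisson equation for the zero-mode-free torus Green function** (position space):
`Σ_μ (2G̃(z) − G̃(z + e_μ) − G̃(z − e_μ)) = 2([z = 0] − L^{-d})`, i.e. `−Δ G̃ = 2(δ₀ − L^{-d})`
(the factor `2` because `G̃` is built on `ε(p) = k̂²/2`). [folklore] -/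
theorem sum_secondDiff_torusGreen (z : TorusSite d L) :
    ∑ μ : Fin d, (2 * torusGreen z - torusGreen (z + Pi.single μ 1) - torusGreen (z - Pi.single μ 1)) =
      2 * ((if z = 0 then (1 : ℝ) else 0) - 1 / (L : ℝ) ^ d) := by
  simp_rw [torusGreen_second_difference]
  rw [← Finset.sum_div, Finset.sum_comm]
  have hL : (0 : ℝ) < (L : ℝ) ^ d := by
    have : (0 : ℝ) < L := by exact_mod_cast Nat.pos_of_ne_zero (NeZero.ne L)
    positivity
  -- pointwise in `k ≠ 0`: `Σ_μ 2(1 − cos p_μ) cos(p·z)/ε(p) = 2 cos(p·z)`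
  have hk : ∀ k ∈ (univ : Finset (TorusSite d L)).erase 0,
      ∑ μ : Fin d, 2 * (1 - Real.cos (latticeMomentum L k μ)) *
          Real.cos (∑ i, latticeMomentum L k i * ((z i).val : ℝ)) / dispersion (latticeMomentum L k) =
        2 * Real.cos (∑ i, latticeMomentum L k i * ((z i).val : ℝ)) := by
    intro k hk
    have hk0 : k ≠ 0 := Finset.ne_of_mem_erase hk
    have hε : dispersion (latticeMomentum L k) ≠ 0 := (dispersion_latticeMomentum_pos hk0).ne'
    rw [← Finset.sum_div, ← Finset.sum_mul, ← Finset.mul_sum]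
    rw [show ∑ μ : Fin d, (1 - Real.cos (latticeMomentum L k μ)) = dispersion (latticeMomentum L k)
      from rfl]
    field_simp
  rw [Finset.sum_congr rfl hk, ← Finset.mul_sum, sum_erase_cos_latticeMomentum]
  split_ifs
  · field_simp
  · field_simp
    ring

/-- **Translation invariance**: the torus sum of a second difference vanishes,
`Σ_z (2G̃(z) − G̃(z + e_μ) − G̃(z − e_μ)) = 0`. [folklore] -/
theorem sum_secondDiff_torusGreen_eq_zero (μ : Fin d) :
    ∑ z : TorusSite d L, (2 * torusGreen z - torusGreen (z + Pi.single μ 1) - torusGreen (z - Pi.single μ 1)) = 0 := by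
  rw [Finset.sum_sub_distrib, Finset.sum_sub_distrib, ← Finset.mul_sum]
  have h1 : ∑ z : TorusSite d L, torusGreen (z + Pi.single μ 1) = ∑ z : TorusSite d L, torusGreen z :=
    Fintype.sum_equiv (Equiv.addRight (Pi.single μ (1 : ZMod L))) _ _ fun z => by
      rw [Equiv.coe_addRight]
  have h2 : ∑ z : TorusSite d L, torusGreen (z - Pi.single μ 1) = ∑ z : TorusSite d L, torusGreen z :=
    Fintype.sum_equiv (Equiv.addRight (-Pi.single μ (1 : ZMod L))) _ _ fun z => by
      rw [Equiv.coe_addRight, sub_eq_add_neg]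
  rw [h1, h2]
  ring

/-- The second difference of `G̃` at the origin in Fourier form:
`2G̃(0) − G̃(e_μ) − G̃(−e_μ) = L^{-d} Σ_k 2(1 − cos p_{k,μ})/ε(p_k)` (the `k = 0` term vanishes, so the
sum may run over all momenta). [folklore] -/
theorem secondDiff_torusGreen_zero_eq_sum (μ : Fin d) :
    2 * torusGreen (0 : TorusSite d L) - torusGreen ((0 : TorusSite d L) + Pi.single μ 1) -
        torusGreen ((0 : TorusSite d L) - Pi.single μ 1) =
      (∑ k : TorusSite d L, 2 * (1 - Real.cos (latticeMomentum L k μ)) / dispersion (latticeMomentum L k)) /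
        (L : ℝ) ^ d := by
  rw [torusGreen_second_difference]
  congr 1
  have h0 : ∀ k : TorusSite d L, Real.cos (∑ i, latticeMomentum L k i * (((0 : TorusSite d L) i).val : ℝ)) = 1 := by
    intro k; simp
  simp_rw [h0, mul_one]
  rw [← Finset.sum_erase_add _ _ (Finset.mem_univ (0 : TorusSite d L))]
  simp [latticeMomentum]

/-- **Isotropy at the origin**: `2G̃(0) − G̃(e_μ) − G̃(−e_μ)` is the same for all directions `μ`
(permute the coordinates `μ ↔ ν` of the momentum). [folklore] -/
theorem secondDiff_torusGreen_zero_eq (μ ν : Fin d) :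
    2 * torusGreen (0 : TorusSite d L) - torusGreen ((0 : TorusSite d L) + Pi.single μ 1) -
        torusGreen ((0 : TorusSite d L) - Pi.single μ 1) =
      2 * torusGreen (0 : TorusSite d L) - torusGreen ((0 : TorusSite d L) + Pi.single ν 1) -
        torusGreen ((0 : TorusSite d L) - Pi.single ν 1) := by
  rw [secondDiff_torusGreen_zero_eq_sum, secondDiff_torusGreen_zero_eq_sum]
  congr 1
  -- reindex the momentum sum by the coordinate transposition `μ ↔ ν`
  refine Fintype.sum_equiv (Equiv.arrowCongr (Equiv.swap μ ν) (Equiv.refl (ZMod L))) _ _ fun k => ?_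
  have hswap : ∀ i, (Equiv.arrowCongr (Equiv.swap μ ν) (Equiv.refl (ZMod L)) k) i = k (Equiv.swap μ ν i) := by
    intro i
    simp [Equiv.arrowCongr_apply, Equiv.symm_swap]
  have hdisp : dispersion (latticeMomentum L (Equiv.arrowCongr (Equiv.swap μ ν) (Equiv.refl (ZMod L)) k)) =
      dispersion (latticeMomentum L k) := by
    unfold dispersion latticeMomentum
    simp_rw [hswap]
    exact Fintype.sum_equiv (Equiv.swap μ ν) _ _ fun i => rfl
  rw [hdisp]
  congr 2
  simp only [latticeMomentum, hswap, Equiv.swap_apply_right]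

/-- **The value**: `2G̃(0) − G̃(e_μ) − G̃(−e_μ) = 2(1 − L^{-d})/d` for every direction `μ` (`d ≥ 1`).
[folklore] -/
theorem secondDiff_torusGreen_zero (hd : 0 < d) (μ : Fin d) :
    2 * torusGreen (0 : TorusSite d L) - torusGreen ((0 : TorusSite d L) + Pi.single μ 1) -
        torusGreen ((0 : TorusSite d L) - Pi.single μ 1) =
      2 * (1 - 1 / (L : ℝ) ^ d) / d := by
  have hsum := sum_secondDiff_torusGreen (d := d) (L := L) 0
  rw [if_pos rfl] at hsum
  rw [Finset.sum_congr rfl fun ν _ => secondDiff_torusGreen_zero_eq (d := d) (L := L) ν μ,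
    Finset.sum_const, Finset.card_univ, Fintype.card_fin, nsmul_eq_mul] at hsum
  have hd' : (0 : ℝ) < d := by exact_mod_cast hd
  field_simp
  linarith

end Summit.QuantumFields.YangMills.Theorems.U1DipoleHelicity
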